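import Mathlib
import HarnessLib
import Literature.MathematicalPhysics.StatisticalMechanics.LinearisedMapLargePartNorm
import Literature.MathematicalPhysics.StatisticalMechanics.LinearisedMap
import Literature.MathematicalPhysics.StatisticalMechanics.LinearisedMapSingleBlock
import Literature.MathematicalPhysics.StatisticalMechanics.RelevantProjectionBound
import Literature.MathematicalPhysics.StatisticalMechanics.BlockNeighbourhoodBox
import Literature.MathematicalPhysics.StatisticalMechanics.WeightGaugeLocality

/-!
# Lemma 10.6 of [ABKM19]: the operator `B_k K = −Π₂ R_{k+1} K(B₀)` is bounded,
# `‖B_k K‖_{k+1,0} ≤ L^d C_{8.7} A_𝒫 A^{−1} ‖K‖_k^{(A)}`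

[ABKM19] (10.40)–(10.43): by translation invariance `H' = B_k K` has the same coefficients on every
block, so `‖B_k K‖_{k+1,0} ≤ max(L^d, 2L^{d/2}, 4) ‖Π₂ R_{k+1}K(B)‖_{k,0} ≤ L^d ‖Π₂ R_{k+1}K(B)‖_{k,0}`
(the three weights of `‖·‖_{k,0}` at scale `k+1` are at most `L^d` times those at scale `k`);
Lemma 8.7 gives `‖Π₂ R_{k+1}K(B)‖_{k,0} ≤ C_{8.7} |R_{k+1}K(B)|_{k,B,T_0}` and the integration property
(w7)/Lemma 8.4 at `φ = 0` (`w_{k:k+1}^B(0) = 1`) gives `|R_{k+1}K(B)|_{k,B,T_0} ≤ A_𝒫 ‖K(B)‖_{k,B}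
≤ A_𝒫 A^{−1} ‖K‖_k^{(A)}`.  In the tree's vocabulary (`opB D K = −Π₂ R K(B₀)`,
`FluctuationOfHamiltonian.opB`; coefficient norm `hamNorm 𝔥 R n`; `WeakNormLE`, `IntegrationProperty`):

* `hamNorm_neg`; `hamNorm_le_mul_of_weights` — comparison of the coefficient norms of two scales
  (termwise: `n' w' ≤ c · n w` for the three weights);
* **`hamNorm_opB_le`** — at the scale-`k` weights: `‖B_k K‖_{𝔥_k,R_k,|B₀|} ≤ C_{8.7} κ A^{−1} C` for
  `‖K‖_k^{(A)} ≤ C` (`κ` the integration constant);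
* **`hamNorm_opB_le_succ`** — at the scale-`(k+1)` weights (`𝔥_{k+1} ≤ 𝔥_k`, `R_k ≤ R_{k+1}`,
  `|B'| = L^d |B₀|`): `‖B_k K‖_{k+1,0} ≤ L^d C_{8.7} κ A^{−1} C` — Lemma 10.6.

Everything here is proved; no named fact.

## References
* S. Adams, S. Buchholz, R. Kotecký, S. Müller, arXiv:1910.13564, Lemma 10.6 ((10.40)–(10.43)),
  Lemma 8.7, Lemma 8.4 [AdamsBuchholzKoteckyMuller2019].
-/

noncomputable section

namespace Literature.MathematicalPhysics.StatisticalMechanics.GradientRG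

open scoped BigOperators Classical
open Finset
open Literature.MathematicalPhysics.StatisticalMechanics.TorusPolymer
  (IsPolymer blocks numBlocks blockOf thicken mem_blockOf_self isPolymer_blockOf blocks_blockOf
    card_blocks_eq_numBlocks boxCorner subset_thicken)
open Literature.Barriers.CriticalPhenomena.LongRangePhi4.Polymer (IsConn)
open Literature.MathematicalPhysics.QuantumFieldTheory

/-! ## The coefficient norm under negation and change of weights -/

section Generic

variable {𝕜 : Type*} [NormedField 𝕜] {d : ℕ}

/-- `‖−H‖_{k,0} = ‖H‖_{k,0}`. [cite: AdamsBuchholzKoteckyMuller2019, Ch. 6.4 (6.51)] -/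
theorem hamNorm_neg (𝔥 R : ℝ) (n : ℕ) (H : RelevantHamiltonian 𝕜 d) :
    hamNorm 𝔥 R n (-H) = hamNorm 𝔥 R n H := by
  unfold hamNorm
  simp only [Pi.neg_apply, norm_neg]

/-- **Comparison of the coefficient norms of two sets of weights**: if each of the three weights
`n'`, `n' 𝔥' R'^{−|α|}`, `n' (𝔥'/R')²` is at most `c` times the corresponding unprimed weight, then
`‖H‖_{𝔥',R',n'} ≤ c ‖H‖_{𝔥,R,n}` ([ABKM19] (10.41): from scale `k` to `k+1` the factors are
`L^d, 2L^{d/2}, 4 ≤ L^d`). [cite: AdamsBuchholzKoteckyMuller2019, Lemma 10.6 (10.41)] -/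
theorem hamNorm_le_mul_of_weights {𝔥 R 𝔥' R' c : ℝ} {n n' : ℕ}
    (hc : (n' : ℝ) ≤ c * n)
    (hl : ∀ α : linIndex d, (n' : ℝ) * (𝔥' * (R' ^ (∑ i, (α : Fin d → ℕ) i))⁻¹) ≤
      c * (n * (𝔥 * (R ^ (∑ i, (α : Fin d → ℕ) i))⁻¹)))
    (hq : (n' : ℝ) * (𝔥' / R') ^ 2 ≤ c * (n * (𝔥 / R) ^ 2)) (H : RelevantHamiltonian 𝕜 d) :
    hamNorm 𝔥' R' n' H ≤ c * hamNorm 𝔥 R n H := by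
  unfold hamNorm
  set c₀ : ℝ := ‖H (Sum.inl ())‖
  set cl : linIndex d → ℝ := fun α => ‖H (Sum.inr (Sum.inl α))‖
  set cq : quadIndex d → ℝ := fun q => ‖H (Sum.inr (Sum.inr q))‖
  have hc₀0 : 0 ≤ c₀ := norm_nonneg _
  have t0 : (n' : ℝ) * c₀ ≤ c * (n * c₀) := by
    have := mul_le_mul_of_nonneg_right hc hc₀0; linarith
  have t1 : (n' : ℝ) * ∑ α : linIndex d, 𝔥' * (R' ^ (∑ i, (α : Fin d → ℕ) i))⁻¹ * cl α ≤
      c * (n * ∑ α : linIndex d, 𝔥 * (R ^ (∑ i, (α : Fin d → ℕ) i))⁻¹ * cl α) := by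
    rw [Finset.mul_sum, Finset.mul_sum, Finset.mul_sum]
    refine Finset.sum_le_sum fun α _ => ?_
    have := mul_le_mul_of_nonneg_right (hl α) (norm_nonneg (H (Sum.inr (Sum.inl α))))
    calc (n' : ℝ) * (𝔥' * (R' ^ (∑ i, (α : Fin d → ℕ) i))⁻¹ * cl α)
        = (n' : ℝ) * (𝔥' * (R' ^ (∑ i, (α : Fin d → ℕ) i))⁻¹) * cl α := by ring
      _ ≤ c * (n * (𝔥 * (R ^ (∑ i, (α : Fin d → ℕ) i))⁻¹)) * cl α := this
      _ = c * (n * (𝔥 * (R ^ (∑ i, (α : Fin d → ℕ) i))⁻¹ * cl α)) := by ring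
  have t2 : (n' : ℝ) * ∑ q, (𝔥' / R') ^ 2 * cq q ≤ c * (n * ∑ q, (𝔥 / R) ^ 2 * cq q) := by
    rw [Finset.mul_sum, Finset.mul_sum, Finset.mul_sum]
    refine Finset.sum_le_sum fun q _ => ?_
    have := mul_le_mul_of_nonneg_right hq (norm_nonneg (H (Sum.inr (Sum.inr q))))
    calc (n' : ℝ) * ((𝔥' / R') ^ 2 * cq q) = (n' : ℝ) * (𝔥' / R') ^ 2 * cq q := by ring
      _ ≤ c * (n * (𝔥 / R) ^ 2) * cq q := this
      _ = c * (n * ((𝔥 / R) ^ 2 * cq q)) := by ring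
  calc (n' : ℝ) * (c₀ + ∑ α : linIndex d, 𝔥' * (R' ^ (∑ i, (α : Fin d → ℕ) i))⁻¹ * cl α +
        ∑ q, (𝔥' / R') ^ 2 * cq q)
      = (n' : ℝ) * c₀ + (n' : ℝ) * ∑ α : linIndex d, 𝔥' * (R' ^ (∑ i, (α : Fin d → ℕ) i))⁻¹ * cl α +
          (n' : ℝ) * ∑ q, (𝔥' / R') ^ 2 * cq q := by ring
    _ ≤ c * (n * c₀) + c * (n * ∑ α : linIndex d, 𝔥 * (R ^ (∑ i, (α : Fin d → ℕ) i))⁻¹ * cl α) +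
          c * (n * ∑ q, (𝔥 / R) ^ 2 * cq q) := add_le_add (add_le_add t0 t1) t2
    _ = c * ((n : ℝ) * (c₀ + ∑ α : linIndex d, 𝔥 * (R ^ (∑ i, (α : Fin d → ℕ) i))⁻¹ * cl α +
          ∑ q, (𝔥 / R) ^ 2 * cq q)) := by ring

/-- **Scale change `k → k+1` of the coefficient norm costs at most `L^d`**: with `n' = L^d n`,
`𝔥' ≤ 𝔥`, `R ≤ R'` (all weights positive), `‖H‖_{𝔥',R',n'} ≤ L^d ‖H‖_{𝔥,R,n}`.
[cite: AdamsBuchholzKoteckyMuller2019, Lemma 10.6 (10.41)] -/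
theorem hamNorm_succ_le {𝔥 R 𝔥' R' : ℝ} {n Ld : ℕ} (h𝔥' : 0 ≤ 𝔥') (h𝔥 : 𝔥' ≤ 𝔥) (hR : 0 < R)
    (hRR' : R ≤ R') (H : RelevantHamiltonian 𝕜 d) :
    hamNorm 𝔥' R' (Ld * n) H ≤ (Ld : ℝ) * hamNorm 𝔥 R n H := by
  have hn : (0 : ℝ) ≤ n := Nat.cast_nonneg _
  have hLd : (0 : ℝ) ≤ Ld := Nat.cast_nonneg _
  have hR' : 0 < R' := hR.trans_le hRR'
  have h𝔥0 : 0 ≤ 𝔥 := h𝔥'.trans h𝔥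
  refine hamNorm_le_mul_of_weights (by push_cast; exact le_rfl) (fun α => ?_) ?_ H
  · push_cast
    have h1 : 𝔥' * (R' ^ (∑ i, (α : Fin d → ℕ) i))⁻¹ ≤ 𝔥 * (R ^ (∑ i, (α : Fin d → ℕ) i))⁻¹ := by
      rw [← div_eq_mul_inv, ← div_eq_mul_inv]
      exact div_le_div₀ h𝔥0 h𝔥 (pow_pos hR _) (pow_le_pow_left₀ hR.le hRR' _)
    calc (Ld : ℝ) * n * (𝔥' * (R' ^ (∑ i, (α : Fin d → ℕ) i))⁻¹)
        ≤ (Ld : ℝ) * n * (𝔥 * (R ^ (∑ i, (α : Fin d → ℕ) i))⁻¹) :=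
          mul_le_mul_of_nonneg_left h1 (mul_nonneg hLd hn)
      _ = (Ld : ℝ) * (n * (𝔥 * (R ^ (∑ i, (α : Fin d → ℕ) i))⁻¹)) := by ring
  · push_cast
    have h1 : (𝔥' / R') ^ 2 ≤ (𝔥 / R) ^ 2 :=
      pow_le_pow_left₀ (div_nonneg h𝔥' hR'.le) (div_le_div₀ h𝔥0 h𝔥 hR hRR') 2
    calc (Ld : ℝ) * n * (𝔥' / R') ^ 2 ≤ (Ld : ℝ) * n * (𝔥 / R) ^ 2 :=
          mul_le_mul_of_nonneg_left h1 (mul_nonneg hLd hn)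
      _ = (Ld : ℝ) * (n * (𝔥 / R) ^ 2) := by ring

end Generic

/-! ## Lemma 10.6 -/

section OpB

variable {d M : ℕ} [NeZero M]

/-- **Lemma 10.6 at the scale-`k` weights**: `‖B_k K‖_{𝔥_k, R_k, |B₀|} ≤ C_{8.7} · C κ A^{−1}` for
`‖K‖_k^{(A)} ≤ C`, the integration property with constant `κ` (Lemma 8.4, evaluated at `φ = 0`
where `w_{k:k+1}^{B₀}(0) = 1`), `K` local and `C^{r₀}` with `C^{r₀}` fluctuation integrals, on the
box `B₀*` (no wrap-around, room for the test polynomials, `ρ' + ⌊d/2⌋ + 1 ≤ C₀ R_k`).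
[cite: AdamsBuchholzKoteckyMuller2019, Lemma 10.6 (10.42)–(10.43)] -/
theorem hamNorm_opB_le (P : NormParams d M) {k t : ℕ} (hM : M = P.L ^ k * t) (hL : Odd P.L)
    (ht : Odd t) (D : StepData d M) {x₀ : Fin d → ZMod M} (hB₀ : D.B₀ = blockOf (P.L ^ k) x₀)
    (hc₀ : D.c₀ = boxCorner (P.L ^ k) (P.rad k) x₀) (h𝔥 : 0 < P.𝔥 k) (hR : 0 < P.R k)
    (hr₀ : 2 ≤ P.r₀) (hwrap : 4 * ((P.L ^ k - 1) / 2 + P.rad k) < M)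
    (hroom : ((2 * ((P.L ^ k - 1) / 2 + P.rad k) : ℕ) + (P.p : ℤ)) * 2 < M)
    {C₀ : ℝ} (hC₀ : 1 ≤ C₀)
    (hρ0 : ((2 * ((P.L ^ k - 1) / 2 + P.rad k) : ℕ) : ℝ) + (d / 2 + 1 : ℕ) ≤ C₀ * P.R k)
    {κ : ℝ} (hint : IntegrationProperty P k D.𝒞 κ)
    {K : Finset (Fin d → ZMod M) → ((Fin d → ZMod M) → ℝ) → ℂ} {C : ℝ} (hC : 0 ≤ C)
    (hK : WeakNormLE P k K C) (hKd : ∀ X, ContDiff ℝ P.r₀ (K X))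
    (hKloc : ∀ X, IsPolymer (P.L ^ k) X → IsConn X → IsGaugeLocal (P.gauge k X) (K X))
    (hRd : ∀ X, ContDiff ℝ P.r₀ (fluct D.𝒞 (K X))) (hA : 1 ≤ P.A) :
    hamNorm (P.𝔥 k) (P.R k) D.B₀.card (opB D K) ≤ pi2BoundConst d C₀ * (C * κ * P.A⁻¹) := by
  set s := P.L ^ k with hsdef
  have hsodd : Odd s := hL.pow
  have hMo : Odd M := by rw [hM]; exact hsodd.mul ht
  have hA0 : 0 < P.A := by linarith
  rw [opB, hamNorm_neg, hB₀]
  -- the box `B₀*`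
  set B := blockOf s x₀ with hBdef
  set S := thicken (P.rad k) B with hSdef
  set ρ' : ℕ := 2 * ((s - 1) / 2 + P.rad k) with hρ'
  have hS : ∀ x, x ∈ S ↔ InBox D.c₀ ρ' x := fun x => by
    rw [hc₀]; exact TorusPolymer.mem_thicken_blockOf_iff_inBox hM hsodd ht hwrap x₀ x
  have hroomS : ∀ x ∈ S, HasRoom D.c₀ x P.p := fun x hx =>
    TorusPolymer.hasRoom_of_inBox ((hS x).1 hx) hroom
  have hSρ : ∀ x ∈ S, ∀ i, |relCoord D.c₀ x i| ≤ ρ' := fun x hx i => by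
    obtain ⟨h1, h2⟩ := (hS x).1 hx i
    rw [abs_of_nonneg h1]; exact h2
  have hBS : B ⊆ S := subset_thicken _ _
  have hBne : B.card ≠ 0 := (card_pos.2 ⟨x₀, mem_blockOf_self s x₀⟩).ne'
  -- `F = R K(B₀)` is local, `C^{r₀}`, and `|F|_{T_0} ≤ C κ A^{-1}`
  have hPB : IsPolymer (P.L ^ k) B := isPolymer_blockOf _ x₀
  have hcB : IsConn B := TorusPolymer.isConn_blockOf hMo hsodd x₀
  have hgauge : P.gauge k B = fieldGauge (P.𝔥 k) (P.R k) P.p S := rfl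
  have hlocK : IsGaugeLocal (fieldGauge (P.𝔥 k) (P.R k) P.p S) (K B) := hKloc _ hPB hcB
  have hlocF : IsGaugeLocal (fieldGauge (P.𝔥 k) (P.R k) P.p S) (fluct D.𝒞 (K B)) :=
    isGaugeLocal_integral _ (stepMeasure D.𝒞) fun ξ => hlocK.comp_add_right _ ξ
  have hnB : numBlocks (P.L ^ k) B = 1 := by
    rw [← card_blocks_eq_numBlocks, blocks_blockOf, card_singleton]
  have hF0 : tayNorm (fieldGauge (P.𝔥 k) (P.R k) P.p S) P.r₀ (fluct D.𝒞 (K B)) 0 ≤ C * κ * P.A⁻¹ := by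
    have h1 := hint _ hPB hcB (K B) (C * P.aFactor k B)
      (mul_nonneg hC (WeakNormLE.aFactor_pos hA0 k _).le) (hKd _) (hgauge ▸ hlocK) (hK _ hPB hcB) 0
    rw [hnB, pow_one, NormParams.aFactor, hnB, pow_one, WeightData.midWeight_zero, mul_one] at h1
    calc _ ≤ C * (P.A)⁻¹ * κ := h1
      _ = C * κ * P.A⁻¹ := by ring
  -- Lemma 8.7
  have h87 := hamNorm_Pi2_le (c := D.c₀) hBne hBS hroomS hSρ h𝔥 hR hC₀ hρ0 hr₀ (hRd _) hlocF
  exact h87.trans (mul_le_mul_of_nonneg_left hF0 (pi2BoundConst_nonneg d (by linarith)))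

/-- **Lemma 10.6 of [ABKM19]: `‖B_k K‖_{k+1,0} ≤ L^d C_{8.7} κ A^{−1} ‖K‖_k^{(A)}`** — the bound of
`hamNorm_opB_le` transported to the scale-`(k+1)` weights (`𝔥_{k+1} ≤ 𝔥_k`, `R_k ≤ R_{k+1}`,
`|B'| = L^d |B₀|`, at a cost `L^d`).  [ABKM19] then take `A ≥ 3 C_{8.7} A_𝒫 L^d` to get
`‖B_k‖ ≤ ⅓`. [cite: AdamsBuchholzKoteckyMuller2019, Lemma 10.6] -/
theorem hamNorm_opB_le_succ (P : NormParams d M) {k t : ℕ} (hM : M = P.L ^ k * t) (hL : Odd P.L)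
    (ht : Odd t) (D : StepData d M) {x₀ : Fin d → ZMod M} (hB₀ : D.B₀ = blockOf (P.L ^ k) x₀)
    (hc₀ : D.c₀ = boxCorner (P.L ^ k) (P.rad k) x₀) (h𝔥' : 0 < P.𝔥 (k + 1))
    (h𝔥le : P.𝔥 (k + 1) ≤ P.𝔥 k) (hR : 0 < P.R k) (hRle : P.R k ≤ P.R (k + 1))
    (hr₀ : 2 ≤ P.r₀) (hwrap : 4 * ((P.L ^ k - 1) / 2 + P.rad k) < M)
    (hroom : ((2 * ((P.L ^ k - 1) / 2 + P.rad k) : ℕ) + (P.p : ℤ)) * 2 < M)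
    {C₀ : ℝ} (hC₀ : 1 ≤ C₀)
    (hρ0 : ((2 * ((P.L ^ k - 1) / 2 + P.rad k) : ℕ) : ℝ) + (d / 2 + 1 : ℕ) ≤ C₀ * P.R k)
    {κ : ℝ} (hint : IntegrationProperty P k D.𝒞 κ)
    {K : Finset (Fin d → ZMod M) → ((Fin d → ZMod M) → ℝ) → ℂ} {C : ℝ} (hC : 0 ≤ C)
    (hK : WeakNormLE P k K C) (hKd : ∀ X, ContDiff ℝ P.r₀ (K X))
    (hKloc : ∀ X, IsPolymer (P.L ^ k) X → IsConn X → IsGaugeLocal (P.gauge k X) (K X))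
    (hRd : ∀ X, ContDiff ℝ P.r₀ (fluct D.𝒞 (K X))) (hA : 1 ≤ P.A) :
    hamNorm (P.𝔥 (k + 1)) (P.R (k + 1)) (P.L ^ d * D.B₀.card) (opB D K) ≤
      (P.L : ℝ) ^ d * (pi2BoundConst d C₀ * (C * κ * P.A⁻¹)) := by
  have h1 := hamNorm_opB_le P hM hL ht D hB₀ hc₀ (h𝔥'.trans_le h𝔥le) hR hr₀ hwrap hroom hC₀ hρ0
    hint hC hK hKd hKloc hRd hA
  have h2 := hamNorm_succ_le (n := D.B₀.card) (Ld := P.L ^ d) h𝔥'.le h𝔥le hR hRle (opB D K)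
  push_cast at h2
  exact h2.trans (mul_le_mul_of_nonneg_left h1 (by positivity))

end OpB

end Literature.MathematicalPhysics.StatisticalMechanics.GradientRG

end
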